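import Summits.Ventures.PercRepro.RankLevelSetLevelSevenArithCubeA
import Summits.Ventures.PercRepro.RankLevelSetLevelSevenArithCubeB
import Summits.Ventures.PercRepro.RankLevelSetLevelSevenArithCubeC
import Summits.Ventures.PercRepro.RankLevelSetLevelSevenArithCubeD
import Summits.Ventures.PercRepro.RankLevelSetLevelSevenArithCubeE
import Summits.Ventures.PercRepro.RankLevelSetLevelSevenArithCubeF
import Summits.Ventures.PercRepro.RankLevelSetLevelSevenArithCubeG
import Summits.Ventures.PercRepro.RankLevelSetLevelSevenArithCubeH

/-!
# PercRepro — THE LEVEL-`7` DISPATCHER OF THE PARTITION CHAIN WITH THE CUBIC MULTIPLICITY: `(P_d)` for `8 ≤ d ≤ 95`, `p ≥ 103`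
(p4, gen 16; a feeder for S4). The 88 cases of RankLevelSetLevelSevenArithCubeA … H in one statement generic in `d`.
Axioms: standard.
-/

namespace PercRepro

namespace ThmN

/-- **`(P_d)` at level `7` in the `7/8` form with the cubic multiplicity (partition count), every corank `8 ≤ d ≤ 95`,
every `p ≥ 103`, in `ℚ`** — the dispatcher of the 88 cases. -/
theorem level_seven_poly_cube (d : ℕ) (hd1 : 8 ≤ d) (hd2 : d ≤ 95) (p : ℕ) (hp : 103 ≤ p) :
    8 * ((((p + d).choose 7 : ℕ) : ℚ) + (∑ j ∈ Finset.range (d - 7), ((Nat.choose (min 71 (max ((d + min 33 d) / 2 + 1) (min 32 (d - 1) + 2) - 2)) j : ℕ) : ℚ) / (((j + 1) + 3 * (j + 1).choose 2 + 3 * (j + 1).choose 3 : ℕ) : ℚ)) *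
      (((d * (d + 1) / 2 : ℕ) : ℚ) * ((p + d).choose 5 : ℚ) + ((d * (d + 1) * (d + 2) / 3 : ℕ) : ℚ) * ((p + d).choose 4 : ℚ) + (((d + 4).choose 5 : ℕ) : ℚ) * ((p + d).choose 3 : ℚ) + (((d + 5).choose 6 : ℕ) : ℚ) * ((p + d).choose 2 : ℚ) + (((d + 6).choose 7 : ℕ) : ℚ) * (p + d : ℚ) + (((d + 7).choose 8 : ℕ) : ℚ)) +
      ((∑ j ∈ Finset.range (d - 7), ((Nat.choose (min 79 (7 + d) - 8) j : ℕ) : ℚ) / (((j + 1) + 3 * (j + 1).choose 2 + 3 * (j + 1).choose 3 : ℕ) : ℚ)) - (∑ j ∈ Finset.range (d - 7), ((Nat.choose (min 32 (d - 1)) j : ℕ) : ℚ) / (((j + 1) + 3 * (j + 1).choose 2 + 3 * (j + 1).choose 3 : ℕ) : ℚ))) *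
      ((d * (d + 1) / 2 * (min 79 (7 + d)).choose 5 + d * (d + 1) * (d + 2) / 3 * (min 79 (7 + d)).choose 4 + (d + 4).choose 5 * (min 79 (7 + d)).choose 3 + (d + 5).choose 6 * (min 79 (7 + d)).choose 2 + (d + 6).choose 7 * (min 79 (7 + d)) + (d + 7).choose 8 : ℕ) : ℚ)) ≤
      7 * 2 ^ (d - 7) * (((p + 7).choose 7 : ℕ) : ℚ) := by
  interval_cases d
  · exact level_seven_poly_cube_8 p hp
  · exact level_seven_poly_cube_9 p hp
  · exact level_seven_poly_cube_10 p hp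
  · exact level_seven_poly_cube_11 p hp
  · exact level_seven_poly_cube_12 p hp
  · exact level_seven_poly_cube_13 p hp
  · exact level_seven_poly_cube_14 p hp
  · exact level_seven_poly_cube_15 p hp
  · exact level_seven_poly_cube_16 p hp
  · exact level_seven_poly_cube_17 p hp
  · exact level_seven_poly_cube_18 p hp
  · exact level_seven_poly_cube_19 p hp
  · exact level_seven_poly_cube_20 p hp
  · exact level_seven_poly_cube_21 p hp
  · exact level_seven_poly_cube_22 p hp
  · exact level_seven_poly_cube_23 p hp
  · exact level_seven_poly_cube_24 p hp
  · exact level_seven_poly_cube_25 p hp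
  · exact level_seven_poly_cube_26 p hp
  · exact level_seven_poly_cube_27 p hp
  · exact level_seven_poly_cube_28 p hp
  · exact level_seven_poly_cube_29 p hp
  · exact level_seven_poly_cube_30 p hp
  · exact level_seven_poly_cube_31 p hp
  · exact level_seven_poly_cube_32 p hp
  · exact level_seven_poly_cube_33 p hp
  · exact level_seven_poly_cube_34 p hp
  · exact level_seven_poly_cube_35 p hp
  · exact level_seven_poly_cube_36 p hp
  · exact level_seven_poly_cube_37 p hp
  · exact level_seven_poly_cube_38 p hp
  · exact level_seven_poly_cube_39 p hp
  · exact level_seven_poly_cube_40 p hp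
  · exact level_seven_poly_cube_41 p hp
  · exact level_seven_poly_cube_42 p hp
  · exact level_seven_poly_cube_43 p hp
  · exact level_seven_poly_cube_44 p hp
  · exact level_seven_poly_cube_45 p hp
  · exact level_seven_poly_cube_46 p hp
  · exact level_seven_poly_cube_47 p hp
  · exact level_seven_poly_cube_48 p hp
  · exact level_seven_poly_cube_49 p hp
  · exact level_seven_poly_cube_50 p hp
  · exact level_seven_poly_cube_51 p hp
  · exact level_seven_poly_cube_52 p hp
  · exact level_seven_poly_cube_53 p hp
  · exact level_seven_poly_cube_54 p hp
  · exact level_seven_poly_cube_55 p hp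
  · exact level_seven_poly_cube_56 p hp
  · exact level_seven_poly_cube_57 p hp
  · exact level_seven_poly_cube_58 p hp
  · exact level_seven_poly_cube_59 p hp
  · exact level_seven_poly_cube_60 p hp
  · exact level_seven_poly_cube_61 p hp
  · exact level_seven_poly_cube_62 p hp
  · exact level_seven_poly_cube_63 p hp
  · exact level_seven_poly_cube_64 p hp
  · exact level_seven_poly_cube_65 p hp
  · exact level_seven_poly_cube_66 p hp
  · exact level_seven_poly_cube_67 p hp
  · exact level_seven_poly_cube_68 p hp
  · exact level_seven_poly_cube_69 p hp
  · exact level_seven_poly_cube_70 p hp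
  · exact level_seven_poly_cube_71 p hp
  · exact level_seven_poly_cube_72 p hp
  · exact level_seven_poly_cube_73 p hp
  · exact level_seven_poly_cube_74 p hp
  · exact level_seven_poly_cube_75 p hp
  · exact level_seven_poly_cube_76 p hp
  · exact level_seven_poly_cube_77 p hp
  · exact level_seven_poly_cube_78 p hp
  · exact level_seven_poly_cube_79 p hp
  · exact level_seven_poly_cube_80 p hp
  · exact level_seven_poly_cube_81 p hp
  · exact level_seven_poly_cube_82 p hp
  · exact level_seven_poly_cube_83 p hp
  · exact level_seven_poly_cube_84 p hp
  · exact level_seven_poly_cube_85 p hp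
  · exact level_seven_poly_cube_86 p hp
  · exact level_seven_poly_cube_87 p hp
  · exact level_seven_poly_cube_88 p hp
  · exact level_seven_poly_cube_89 p hp
  · exact level_seven_poly_cube_90 p hp
  · exact level_seven_poly_cube_91 p hp
  · exact level_seven_poly_cube_92 p hp
  · exact level_seven_poly_cube_93 p hp
  · exact level_seven_poly_cube_94 p hp
  · exact level_seven_poly_cube_95 p hp

end ThmN

end PercRepro
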